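import Literature.NumberTheory.EllipticCurves.QuadraticTwistLocalDataAtTwoProofs
import Literature.NumberTheory.EllipticCurves.QuadraticTwistGoodReductionCharTwoSupersingularProofs
import Literature.NumberTheory.EllipticCurves.NeronComponentIndexTypeInstarProofs
import Literature.NumberTheory.EllipticCurves.QuadraticTwistJInvariantProofs
import Literature.NumberTheory.EllipticCurves.QuadraticTwistIntegralModel
import Literature.NumberTheory.EllipticCurves.GlobalMinimalModelProofs
import Literature.NumberTheory.EllipticCurves.TamagawaProofs
import Literature.NumberTheory.DiophantineGeometry.TateAlgorithmExitMinimalityProofs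
import HarnessLib

/-!
# Quadratic twists at `2` of a curve with good reduction over `ℚ₂`: the `ℤ₂`-glue
# (Kodaira symbol and local Tamagawa number read on an explicit model; the unramified twist)

`Proofs` file (theorems only, no definitions, no named facts, no global instances) in topic
`NumberTheory/EllipticCurves`, third part of the discharge of the named fact
`Literature.NumberTheory.EllipticCurves.BarriosEtAl2025_quadraticTwist_two_of_goodReduction`
(Barrios–Roy–Sahajpal–Tallana–Tobin–Wiersema, Res. Number Theory 11 (2025), Thm. 5.1, rows
`R = I₀`; `QuadraticTwistLocalDataAtTwo`), after the DVR-level computations of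
`QuadraticTwistGoodReductionCharTwoProofs` / `…SupersingularProofs` and the minimality criterion
`TateAlgorithmExitMinimalityProofs`.  Here everything is specialised to Mathlib's `ℤ_[2] ⊆ ℚ_[2]`:

* `exists_isUnit_two_eq_uniformizer_mul_padicInt` — `2 = ϖ ε` in `ℤ₂` (`PadicInt.irreducible_p`);
  `perfectField_residueField_padicInt`, `henselianLocalRing_padicInt` — the standing hypotheses of
  Tate's algorithm and of the `LocalIndex` files hold for `ℤ₂`;
* `isUnit_Δ_integralModel_of_hasGoodReduction` — good reduction gives a unit discriminant on the
  integral minimal model;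
* `kodairaSymbol_and_localTamagawaNumber_of_model_padic` — **if `C • X = N ⊗ ℚ₂` with `N` over
  `ℤ₂` and the literal algorithm does not return `I₀` on `N`**, then `X.kodairaSymbol ℤ₂` is the
  value computed on `N` (`kodairaSymbol_eq_of_smul_eq_baseChange_of_ne_I_zero`: `N` is
  automatically minimal), and the local Tamagawa number `c(X) = [X(ℚ₂) : X₀(ℚ₂)]` is `1` for the
  types `II`, `II*` and `2` or `4` for `Iₙ*`, `n ≥ 1` (Silverman *ATAEC* IV.9.4 Steps 3, 7, 10,
  tree `LocalIndex.index_goodReductionSubgroup_eq_one`,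
  `LocalIndex.index_mem_of_kodairaSymbolOfMinimal_eq_Istar_succ`);
* `kodairaSymbol_and_localTamagawaNumber_quadraticTwist_of_one_mod_four` — for `d = 4k + 1` the
  twist of a curve with good reduction has good reduction (`twistModel`): Kodaira symbol `I₀`,
  `c = 1` (Barrios et al., table `v(d) = 0`, row `I₀`, `d ≡ 1 mod 4`: `I₀`, `(c, c^d) = (1, 1)`).

## References

* A. J. Barrios, M. Roy, N. Sahajpal, D. Tallana, B. Tobin, H. Wiersema, *Local data of elliptic
  curves under quadratic twist*, Res. Number Theory 11 (2025), Thm. 5.1 and §5 tables, rows `I₀`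
  (arXiv:2501.03209 pp. 15–16). [BarriosEtAl2025]
* J. H. Silverman, *Advanced Topics in the Arithmetic of Elliptic Curves*, GTM 151 (1994), IV.9.4
  (Tate's algorithm), Steps 1, 3, 7, 10 and Table 4.1. [SilvermanATAEC1994]
* J. H. Silverman, *The Arithmetic of Elliptic Curves*, 2nd ed. (2009), VII.1 Prop. 1.3(b),
  VII.2 Prop. 2.1, VII.6. [SilvermanAEC2009]
-/

noncomputable section

open scoped Classical

open IsLocalRing IsDedekindDomain
open IsDiscreteValuationRing hiding maximalIdeal

namespace Literature.NumberTheory.EllipticCurves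

namespace TwistGoodTwo

open Literature.NumberTheory.DiophantineGeometry Literature.NumberTheory.DiophantineGeometry.TateAlgorithm

/-! ### `ℤ₂` as a DVR with `2` a uniformiser -/

/-- In `ℤ₂`, `2 = ϖ ε` for the chosen uniformiser `ϖ` of Tate's algorithm and a unit `ε`
(`2` is irreducible, `PadicInt.irreducible_p`, and irreducibles of a DVR are associated); the
normalisation `π = 2` of Tate's algorithm over `ℤ₂`. [cite: SilvermanATAEC1994, IV.9.4 (PDF p. 344)] -/
theorem exists_isUnit_two_eq_uniformizer_mul_padicInt :
    ∃ ε : ℤ_[2], IsUnit ε ∧ (2 : ℤ_[2]) = uniformizer ℤ_[2] * ε := by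
  have h2 : Irreducible (2 : ℤ_[2]) := by
    have := PadicInt.irreducible_p (p := 2)
    rwa [Nat.cast_ofNat] at this
  obtain ⟨u, hu⟩ := IsDiscreteValuationRing.associated_of_irreducible ℤ_[2]
    irreducible_uniformizer h2
  exact ⟨u, u.isUnit, hu.symm⟩

/-- The residue field of `ℤ₂` is finite (`≅ 𝔽₂`), hence perfect (the standing hypothesis
"perfect residue field" of Tate's algorithm). [cite: SilvermanATAEC1994, IV.9 (setting, PDF p. 339)] -/
theorem perfectField_residueField_padicInt : PerfectField (ResidueField ℤ_[2]) := by
  haveI : Finite (ResidueField ℤ_[2]) :=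
    Finite.of_equiv (ZMod 2) (PadicInt.residueField (p := 2)).symm.toEquiv
  exact PerfectField.ofFinite

/-- `ℤ₂` is Henselian (it is `2`-adically complete; the setting of Silverman *ATAEC* IV.9,
Cor. 9.2(b): "If `K` is complete, or even merely Henselian"). [cite: SilvermanATAEC1994, IV.9 Cor. 9.2(b) (PDF p. 340)] -/
theorem henselianLocalRing_padicInt : HenselianLocalRing ℤ_[2] :=
  { is_henselian := fun f hf a₀ h₁ h₂ =>
      HenselianRing.is_henselian (I := IsLocalRing.maximalIdeal ℤ_[2]) f hf a₀ h₁ (h₂.map _) }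

/-! ### Good reduction: a unit discriminant on the integral minimal model -/

section DVR

variable {R : Type*} [CommRing R] [IsDomain R] [IsDiscreteValuationRing R]
  {K : Type*} [Field K] [Algebra R K] [IsFractionRing R K]

/-- If a Weierstrass equation over `K` has good reduction (Mathlib: minimal with `v(Δ) = 1`), the
discriminant of its integral model is a unit of `R`. Silverman *AEC* VII.5.1(a).
[cite: SilvermanAEC2009, VII.5 Prop. 5.1(a)] -/
theorem isUnit_Δ_integralModel_of_hasGoodReduction (W : WeierstrassCurve K)
    [hW : W.HasGoodReduction R] : IsUnit (W.integralModel R).Δ := by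
  have h := hW.goodReduction
  rw [← WeierstrassCurve.integralModel_Δ_eq R W, HeightOneSpectrum.valuation_of_algebraMap] at h
  by_contra hu
  have hmem : (W.integralModel R).Δ ∈ (IsDiscreteValuationRing.maximalIdeal R).asIdeal :=
    (IsLocalRing.mem_maximalIdeal _).mpr hu
  have hlt := (HeightOneSpectrum.intValuation_lt_one_iff_mem _ _).mpr hmem
  rw [h] at hlt
  exact lt_irrefl _ hlt

/-- Conversely a unit discriminant on an `R`-model gives `v(Δ) = 1` for its base change.
[folklore] -/
private theorem valuation_Δ_baseChange_eq_one_of_isUnit (N : WeierstrassCurve R) (hN : IsUnit N.Δ) :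
    HeightOneSpectrum.valuation K (IsDiscreteValuationRing.maximalIdeal R) (N.baseChange K).Δ = 1 := by
  rw [WeierstrassCurve.baseChange, WeierstrassCurve.map_Δ, HeightOneSpectrum.valuation_of_algebraMap]
  refine le_antisymm (HeightOneSpectrum.intValuation_le_one _ _) (not_lt.mp fun hlt ↦ ?_)
  have hmem := (HeightOneSpectrum.intValuation_lt_one_iff_mem _ _).mp hlt
  exact (IsLocalRing.mem_maximalIdeal _).mp hmem hN

/-- Step 1 of Tate's algorithm: on a model with unit discriminant the literal algorithm returns
`I₀`. Silverman *ATAEC* IV.9.4 Step 1. [cite: SilvermanATAEC1994, IV.9.4 Step 1 (PDF p. 344)] -/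
theorem kodairaSymbolOfMinimal_eq_I_zero_of_isUnit_Δ (N : WeierstrassCurve R) (hN : IsUnit N.Δ) :
    N.kodairaSymbolOfMinimal = .I 0 := by
  unfold WeierstrassCurve.kodairaSymbolOfMinimal
  simp only []
  rw [if_pos (fun h ↦ (IsLocalRing.mem_maximalIdeal _).mp h hN)]

end DVR

/-- An odd integer is a unit of `ℤ₂` when `2 = ϖ ε` (it is `1 + ϖ(⋯)`). [folklore] -/
private theorem isUnit_intCast_of_odd'' {ε : ℤ_[2]} (hε : (2 : ℤ_[2]) = uniformizer ℤ_[2] * ε) {n : ℤ}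
    (hn : Odd n) : IsUnit (n : ℤ_[2]) := by
  obtain ⟨k, rfl⟩ := hn
  have e : ((2 * k + 1 : ℤ) : ℤ_[2]) = 1 + uniformizer ℤ_[2] * (ε * k) := by
    push_cast; rw [hε]; ring
  rw [e]
  exact isUnit_one_add_uniformizer_mul _

/-! ### Reading the Kodaira symbol and `c` of a curve over `ℚ₂` on an explicit `ℤ₂`-model -/

/-- **Kodaira symbol and local Tamagawa number read on an explicit `ℤ₂`-model.**  Let `X / ℚ₂`
be an elliptic curve, `N` a Weierstrass equation over `ℤ₂` and `C • X = N ⊗ ℚ₂`.  If Tate's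
algorithm run literally on `N` does not return `I₀` (so `N` is a minimal equation,
`isMinimal_baseChange_of_kodairaSymbolOfMinimal_ne_I_zero`), then
`X.kodairaSymbol ℤ₂ = N.kodairaSymbolOfMinimal`; if this value is `II` or `II*` then
`c(X) = [X(ℚ₂) : X₀(ℚ₂)] = 1`, and if it is `Iₙ*` with `n ≥ 1` then `c(X) ∈ {2, 4}`
(Silverman *ATAEC* IV.9.4, Steps 3, 7, 10 with Rem. IV.9.3: `c = 1`, `c = 2 or 4`, `c = 1`;
the index is computed on `N ⊗ ℚ₂` by `localTamagawaNumber_variableChange` and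
`index_goodReductionSubgroup_eq_of_eq_smul`).
[cite: SilvermanATAEC1994, IV.9.4 Steps 3, 7, 10 (PDF pp. 344–346) with Rem. IV.9.3 (PDF p. 341)] -/
theorem kodairaSymbol_and_localTamagawaNumber_of_model_padic (X : WeierstrassCurve ℚ_[2])
    [X.IsElliptic] (N : WeierstrassCurve ℤ_[2]) (C : WeierstrassCurve.VariableChange ℚ_[2])
    (h : C • X = N.baseChange ℚ_[2]) (hN : N.kodairaSymbolOfMinimal ≠ .I 0) :
    X.kodairaSymbol ℤ_[2] = N.kodairaSymbolOfMinimal ∧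
      ((N.kodairaSymbolOfMinimal = .II ∨ N.kodairaSymbolOfMinimal = .IIstar) →
        X.localTamagawaNumber ℤ_[2] = 1) ∧
      (∀ n : ℕ, N.kodairaSymbolOfMinimal = .Istar (n + 1) →
        X.localTamagawaNumber ℤ_[2] = 2 ∨ X.localTamagawaNumber ℤ_[2] = 4) := by
  haveI := perfectField_residueField_padicInt
  haveI := henselianLocalRing_padicInt
  haveI hNe : (N.baseChange ℚ_[2]).IsElliptic := h ▸ inferInstance
  have hΔN : N.Δ ≠ 0 := by
    intro h0
    apply (N.baseChange ℚ_[2]).isUnit_Δ.ne_zero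
    rw [WeierstrassCurve.baseChange, WeierstrassCurve.map_Δ, h0, map_zero]
  haveI hmin : (N.baseChange ℚ_[2]).IsMinimal ℤ_[2] :=
    WeierstrassCurve.isMinimal_baseChange_of_kodairaSymbolOfMinimal_ne_I_zero N hN
  -- `c(X)` is the index of `E₀` on the minimal model `N ⊗ ℚ₂`
  have hc : X.localTamagawaNumber ℤ_[2] = ((N.baseChange ℚ_[2]).goodReductionSubgroup ℤ_[2]).index := by
    have h1 : (C • X).localTamagawaNumber ℤ_[2] = X.localTamagawaNumber ℤ_[2] :=
      WeierstrassCurve.localTamagawaNumber_variableChange_holds (R := ℤ_[2]) X C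
    rw [← h1, h]
    unfold WeierstrassCurve.localTamagawaNumber
    exact WeierstrassCurve.index_goodReductionSubgroup_eq_of_eq_smul ℤ_[2]
      (D := ((N.baseChange ℚ_[2]).exists_isMinimal ℤ_[2]).choose) rfl
      (N.baseChange ℚ_[2]).isUnit_Δ.ne_zero
  refine ⟨WeierstrassCurve.kodairaSymbol_eq_of_smul_eq_baseChange_of_ne_I_zero X C N h hΔN hN,
    fun hII ↦ ?_,
    fun n hI ↦ ?_⟩
  · rw [hc]
    refine LocalIndex.index_goodReductionSubgroup_eq_one (R := ℤ_[2]) (N.baseChange ℚ_[2]) ?_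
    rwa [WeierstrassCurve.integralModel_baseChange_eq]
  · rw [hc, WeierstrassCurve.goodReductionSubgroup_baseChange_eq]
    exact LocalIndex.index_mem_of_kodairaSymbolOfMinimal_eq_Istar_succ (K := ℚ_[2]) N hΔN hI

/-! ### The unramified square class `d ≡ 1 (mod 4)`: good reduction persists -/

/-- **`d ≡ 1 (mod 4)`: the twist of a curve with good reduction at `2` has good reduction, Kodaira
symbol `I₀` and `c = 1`.**  If `C₁ • E = V ⊗ ℚ₂` with `V` over `ℤ₂` of unit discriminant and
`d = 4k + 1`, the integral twist model `V.twistModel k` (`y² + a₁xy + d a₃y = x³ + ⋯`, Connell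
§4.3) is a `ℤ₂`-model of `E^{(d)}` with discriminant `d⁶ Δ(V)`, a unit; hence it is minimal with
good reduction, Step 1 of Tate's algorithm returns `I₀`, and `E₀ = E` (`c = 1`).  Barrios et al.
2025, Thm. 5.1, table `v(d) = 0`, row `I₀`, `d ≡ 1 mod 4`: `I₀`, `(c, c^d) = (1, 1)`; Silverman
*ATAEC* IV.9.4 Step 1; *AEC* VII.2, remark after Prop. 2.1.
[cite: BarriosEtAl2025, Thm. 5.1, §5 table v(d) = 0, row I₀ (arXiv p. 15)]
[cite: SilvermanATAEC1994, IV.9.4 Step 1 (PDF p. 344)] -/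
theorem kodairaSymbol_and_localTamagawaNumber_quadraticTwist_of_one_mod_four {ε : ℤ_[2]}
    (hε : (2 : ℤ_[2]) = uniformizer ℤ_[2] * ε) (E : WeierstrassCurve ℚ_[2]) [E.IsElliptic]
    (V : WeierstrassCurve ℤ_[2]) (hV : IsUnit V.Δ) (C₁ : WeierstrassCurve.VariableChange ℚ_[2])
    (hVE : C₁ • E = V.baseChange ℚ_[2]) {d k : ℤ} (hd : d = 4 * k + 1) :
    (E.quadraticTwist (d : ℚ_[2])).kodairaSymbol ℤ_[2] = .I 0 ∧
      (E.quadraticTwist (d : ℚ_[2])).localTamagawaNumber ℤ_[2] = 1 := by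
  haveI := perfectField_residueField_padicInt
  have hd0 : (d : ℚ_[2]) ≠ 0 := by
    have : (d : ℤ) ≠ 0 := by omega
    exact_mod_cast this
  haveI hXe : (E.quadraticTwist (d : ℚ_[2])).IsElliptic := WeierstrassCurve.isElliptic_quadraticTwist E hd0
  -- the integral twist model and its unit discriminant
  set N : WeierstrassCurve ℤ_[2] := V.twistModel (k : ℤ_[2]) with hN
  have hdu : IsUnit ((4 * (k : ℤ_[2]) + 1)) := by
    have := isUnit_intCast_of_odd'' hε (n := 4 * k + 1) ⟨2 * k, by ring⟩
    push_cast at this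
    exact this
  have hNΔ : IsUnit N.Δ := by rw [hN, WeierstrassCurve.twistModel_Δ]; exact (hdu.pow 6).mul hV
  -- `N ⊗ ℚ₂` is a model of the twist
  have hNK : N.baseChange ℚ_[2] = (V.baseChange ℚ_[2]).twistModel (k : ℚ_[2]) := by
    rw [hN, WeierstrassCurve.baseChange, WeierstrassCurve.map_twistModel, map_intCast]; rfl
  obtain ⟨Ct, -, hCt⟩ :=
    (V.baseChange ℚ_[2]).exists_variableChange_twistModel_eq_quadraticTwist (k : ℚ_[2])
  have hdK : ((d : ℚ_[2])) = 4 * (k : ℚ_[2]) + 1 := by rw [hd]; push_cast; ring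
  have htw : (V.baseChange ℚ_[2]).quadraticTwist (d : ℚ_[2]) =
      (⟨C₁.u, (d : ℚ_[2]) * C₁.r, 0, 0⟩ : WeierstrassCurve.VariableChange ℚ_[2]) •
        E.quadraticTwist (d : ℚ_[2]) := by
    rw [← hVE, WeierstrassCurve.quadraticTwist_smul]
  set C : WeierstrassCurve.VariableChange ℚ_[2] := Ct⁻¹ * ⟨C₁.u, (d : ℚ_[2]) * C₁.r, 0, 0⟩ with hC
  have hmodel : C • E.quadraticTwist (d : ℚ_[2]) = N.baseChange ℚ_[2] := by
    rw [hC, mul_smul, ← htw, hdK, ← hCt, inv_smul_smul, hNK]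
  -- minimality and good reduction of `N ⊗ ℚ₂`
  haveI : WeierstrassCurve.IsIntegral ℤ_[2] (N.baseChange ℚ_[2]) := ⟨⟨N, rfl⟩⟩
  have hval := valuation_Δ_baseChange_eq_one_of_isUnit (K := ℚ_[2]) N hNΔ
  haveI hmin : (N.baseChange ℚ_[2]).IsMinimal ℤ_[2] :=
    WeierstrassCurve.isMinimal_of_valuation_Δ_eq_one _ hval
  haveI hgood : (N.baseChange ℚ_[2]).HasGoodReduction ℤ_[2] := ⟨hval⟩
  have hΔK : (N.baseChange ℚ_[2]).Δ ≠ 0 := by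
    rw [WeierstrassCurve.baseChange, WeierstrassCurve.map_Δ]
    exact (map_ne_zero_iff _ (IsFractionRing.injective ℤ_[2] ℚ_[2])).mpr hNΔ.ne_zero
  refine ⟨?_, ?_⟩
  · rw [← WeierstrassCurve.kodairaSymbol_smul_holds ℤ_[2] (E.quadraticTwist (d : ℚ_[2])) C, hmodel,
      WeierstrassCurve.kodairaSymbol_eq_kodairaSymbolOfMinimal_of_isMinimal ℤ_[2] (N.baseChange ℚ_[2])
        (N.baseChange ℚ_[2]) 1 (one_smul _ _).symm hΔK,
      WeierstrassCurve.integralModel_baseChange_eq]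
    exact kodairaSymbolOfMinimal_eq_I_zero_of_isUnit_Δ N hNΔ
  · have h1 : (C • E.quadraticTwist (d : ℚ_[2])).localTamagawaNumber ℤ_[2] =
        (E.quadraticTwist (d : ℚ_[2])).localTamagawaNumber ℤ_[2] :=
      WeierstrassCurve.localTamagawaNumber_variableChange_holds (R := ℤ_[2])
        (E.quadraticTwist (d : ℚ_[2])) C
    rw [← h1, hmodel]
    haveI : (N.baseChange ℚ_[2]).IsElliptic := hmodel ▸ inferInstance
    unfold WeierstrassCurve.localTamagawaNumber
    have hidx : (((N.baseChange ℚ_[2]).minimal ℤ_[2]).goodReductionSubgroup ℤ_[2]).index =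
        ((N.baseChange ℚ_[2]).goodReductionSubgroup ℤ_[2]).index :=
      WeierstrassCurve.index_goodReductionSubgroup_eq_of_eq_smul ℤ_[2]
        (W₂ := (N.baseChange ℚ_[2]).minimal ℤ_[2])
        (D := ((N.baseChange ℚ_[2]).exists_isMinimal ℤ_[2]).choose) rfl hΔK
    rw [hidx, WeierstrassCurve.goodReductionSubgroup_eq_top_of_hasGoodReduction,
      AddSubgroup.index_top]

end TwistGoodTwo

end Literature.NumberTheory.EllipticCurves

end
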